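import Mathlib
import Summits.ResolutionOfSingularities.ResolutionOfSingularities.Theorems.WeightedInvariantLocalWeightedDropTOT2BranchChartInvariance
import Summits.ResolutionOfSingularities.ResolutionOfSingularities.Theorems.WeightedInvariantLocalWeightedDropTOT2ChartComapInjective
import Summits.ResolutionOfSingularities.ResolutionOfSingularities.Theorems.WeightedInvariantLocalWeightedDropTOT2PairValFinite

/-!
# TOT2-LINE (P3): THE BRICK HYPOTHESES `hB3`, `hinj`, `hD3` OF THE B6 STEP THEOREMS, DISCHARGED IN THEIR EXACT BINDER SHAPES

Sub-problem `ResolutionOfSingularities`, ENGINE crux `stmt-ResolutionOfSingularities-8899` (`LocalWeightedDrop`), skeleton v35 (2e806da509994632),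
registered stub `stub_conflictBudget` (P3).  The step theorems of res-L1-w43-stub-2 g6 / res-L1-w43-lead-1 g6 (`…TOT2StepBlowOneDim`,
`…TOT2StepCurve(Dim)`, `…TOT2StepBlowTwo(Dim)`, `…TOT2StepTranslated`, the graph step) take the bricks B3 (chart invariance of `branchVal`), D3
(`pairVal_lt_top`) and the injectivity of the comap as HYPOTHESES `hB3`, `hD3`, `hinj` over an abstract chart map `Φ`.  This file records, for the
glue `conflictBudget_laws`, the DISCHARGE of these hypotheses for the four monomial charts `Φ = substAlgHom ha` of the literal families
`![X 0, X 0 * X 1, X 0 * X 2]` (u₁-origin), `![X 0 * X 1, X 1, X 1 * X 2]` (u₂-origin), `![X 0, X 1, X 0 * X 2]` (blow-up of `V(y,u₁)`),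
`![X 0, X 1, X 1 * X 2]` (blow-up of `V(y,u₂)`) — any proof `ha` of substitutability, by proof irrelevance — in EXACTLY the binder shapes of the
step theorems (so the glue passes `hB3_chartOne ha`, `hinj_chartOne ha`, `hD3_of_two_le hd2`, … positionally; NOTE `substAlgHom ha f` and
`subst a f` are NOT syntactically interchangeable under `exact` — the conversion `substAlgHom_apply` is done here).  For the composites with formal
coordinate changes (translated point, graph move) use `branchVal_comap_monomialChart_(comp_)coordChange` /
`eq_of_comap_monomialChart_(comp_)coordChange_eq` of `…TOT2BranchCoordChange` (once per coordinate change).  [OURS · L1 W4.3 · chain w43 · res-L1-w43-stub-1 g7.  Engine bookkeeping;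
nothing here is a statement of any manuscript; AI-produced, gate-checked, weaker than expert review.  «[OURS · L1 W4.3] replaces the role of
nothing printed; NOT a statement of the manuscript.»]
-/

set_option linter.dupNamespace false -- mandated namespace of this single-conjunct summit

noncomputable section

namespace Summit.ResolutionOfSingularities.ResolutionOfSingularities.Theorems

namespace TOT2Branch

open MvPowerSeries IsLocalRing

variable {k : Type} [Field k]

/-! ## `hD3` (chart-independent) -/

/-- **`hD3`** of the step theorems, from `pairVal_lt_top`. -/
theorem hD3_of_two_le {d : ℕ} (hd : 2 ≤ d) {A : Fin d → MvPowerSeries (Fin 2) k} :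
    ∀ (P Q : Ideal (MvPowerSeries (Fin 3) k)), P ∈ topPrimes d A → Q ∈ topPrimes d A → P ≠ Q →
      ringKrullDim (MvPowerSeries (Fin 3) k ⧸ P) = 1 → ringKrullDim (MvPowerSeries (Fin 3) k ⧸ Q) = 1 → pairVal P Q < ⊤ :=
  fun _ _ hP hQ hne hdP hdQ => pairVal_lt_top hd hP hQ hne hdP hdQ

/-! ## `hB3` and `hinj` for a monomial substitution (generic in the exceptional variable) -/

/-- **`hB3`** for a monomial substitution `a` with exceptional variable `X j`. -/
theorem hB3_substAlgHom {a : Fin 3 → MvPowerSeries (Fin 3) k} (ha : HasSubst a) (j : Fin 3) (hfix : a j = X j)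
    (hmon : ∀ i : Fin 3, a i = X i ∨ a i = X j * X i) :
    ∀ (P' : Ideal (MvPowerSeries (Fin 3) k)) [P'.IsPrime], ringKrullDim (MvPowerSeries (Fin 3) k ⧸ P') = 1 →
      (X j : MvPowerSeries (Fin 3) k) ∉ P' →
      ringKrullDim (MvPowerSeries (Fin 3) k ⧸ P'.comap (substAlgHom ha : MvPowerSeries (Fin 3) k →ₐ[k] MvPowerSeries (Fin 3) k)) = 1 ∧
        ∀ f, branchVal (P'.comap (substAlgHom ha : MvPowerSeries (Fin 3) k →ₐ[k] MvPowerSeries (Fin 3) k)) f =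
          branchVal P' ((substAlgHom ha : MvPowerSeries (Fin 3) k →ₐ[k] MvPowerSeries (Fin 3) k) f) :=
  fun P' _ hdim' hj => by
    obtain ⟨h1, h2⟩ := branchVal_comap_substAlgHom ha j hfix hmon P' hdim' hj
    exact ⟨h1, fun f => by rw [substAlgHom_apply]; exact h2 f⟩

/-- **`hinj`** for a monomial substitution `a` with exceptional variable `X j`. -/
theorem hinj_substAlgHom {a : Fin 3 → MvPowerSeries (Fin 3) k} (ha : HasSubst a) (j : Fin 3) (hfix : a j = X j)
    (hmon : ∀ i : Fin 3, a i = X i ∨ a i = X j * X i) :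
    ∀ (P' Q' : Ideal (MvPowerSeries (Fin 3) k)), P'.IsPrime → Q'.IsPrime → ringKrullDim (MvPowerSeries (Fin 3) k ⧸ P') = 1 →
      ringKrullDim (MvPowerSeries (Fin 3) k ⧸ Q') = 1 → (X j : MvPowerSeries (Fin 3) k) ∉ P' → (X j : MvPowerSeries (Fin 3) k) ∉ Q' →
      P'.comap (substAlgHom ha : MvPowerSeries (Fin 3) k →ₐ[k] MvPowerSeries (Fin 3) k) =
        Q'.comap (substAlgHom ha : MvPowerSeries (Fin 3) k →ₐ[k] MvPowerSeries (Fin 3) k) → P' = Q' :=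
  fun _ _ hP hQ hdP hdQ hXP hXQ h => eq_of_comap_eq_of_substAlgHom ha j hfix hmon hP hQ hdP hdQ hXP hXQ h

/-! ## The four charts -/

/-- **`hB3` for the `u₁`-origin chart** (exceptional variable `X 0`). -/
theorem hB3_chartOne (ha : HasSubst (![X 0, X 0 * X 1, X 0 * X 2] : Fin 3 → MvPowerSeries (Fin 3) k)) :
    ∀ (P' : Ideal (MvPowerSeries (Fin 3) k)) [P'.IsPrime], ringKrullDim (MvPowerSeries (Fin 3) k ⧸ P') = 1 →
      (X 0 : MvPowerSeries (Fin 3) k) ∉ P' →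
      ringKrullDim (MvPowerSeries (Fin 3) k ⧸ P'.comap (substAlgHom ha : MvPowerSeries (Fin 3) k →ₐ[k] MvPowerSeries (Fin 3) k)) = 1 ∧
        ∀ f, branchVal (P'.comap (substAlgHom ha : MvPowerSeries (Fin 3) k →ₐ[k] MvPowerSeries (Fin 3) k)) f =
          branchVal P' ((substAlgHom ha : MvPowerSeries (Fin 3) k →ₐ[k] MvPowerSeries (Fin 3) k) f) :=
  hB3_substAlgHom ha 0 (by simp) (fun i => by fin_cases i <;> simp)

/-- **`hinj` for the `u₁`-origin chart.** -/
theorem hinj_chartOne (ha : HasSubst (![X 0, X 0 * X 1, X 0 * X 2] : Fin 3 → MvPowerSeries (Fin 3) k)) :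
    ∀ (P' Q' : Ideal (MvPowerSeries (Fin 3) k)), P'.IsPrime → Q'.IsPrime → ringKrullDim (MvPowerSeries (Fin 3) k ⧸ P') = 1 →
      ringKrullDim (MvPowerSeries (Fin 3) k ⧸ Q') = 1 → (X 0 : MvPowerSeries (Fin 3) k) ∉ P' → (X 0 : MvPowerSeries (Fin 3) k) ∉ Q' →
      P'.comap (substAlgHom ha : MvPowerSeries (Fin 3) k →ₐ[k] MvPowerSeries (Fin 3) k) =
        Q'.comap (substAlgHom ha : MvPowerSeries (Fin 3) k →ₐ[k] MvPowerSeries (Fin 3) k) → P' = Q' :=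
  hinj_substAlgHom ha 0 (by simp) (fun i => by fin_cases i <;> simp)

/-- **`hB3` for the `u₂`-origin chart** (exceptional variable `X 1`). -/
theorem hB3_chartTwo (ha : HasSubst (![X 0 * X 1, X 1, X 1 * X 2] : Fin 3 → MvPowerSeries (Fin 3) k)) :
    ∀ (P' : Ideal (MvPowerSeries (Fin 3) k)) [P'.IsPrime], ringKrullDim (MvPowerSeries (Fin 3) k ⧸ P') = 1 →
      (X 1 : MvPowerSeries (Fin 3) k) ∉ P' →
      ringKrullDim (MvPowerSeries (Fin 3) k ⧸ P'.comap (substAlgHom ha : MvPowerSeries (Fin 3) k →ₐ[k] MvPowerSeries (Fin 3) k)) = 1 ∧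
        ∀ f, branchVal (P'.comap (substAlgHom ha : MvPowerSeries (Fin 3) k →ₐ[k] MvPowerSeries (Fin 3) k)) f =
          branchVal P' ((substAlgHom ha : MvPowerSeries (Fin 3) k →ₐ[k] MvPowerSeries (Fin 3) k) f) :=
  hB3_substAlgHom ha 1 (by simp) (fun i => by fin_cases i <;> simp [mul_comm])

/-- **`hinj` for the `u₂`-origin chart.** -/
theorem hinj_chartTwo (ha : HasSubst (![X 0 * X 1, X 1, X 1 * X 2] : Fin 3 → MvPowerSeries (Fin 3) k)) :
    ∀ (P' Q' : Ideal (MvPowerSeries (Fin 3) k)), P'.IsPrime → Q'.IsPrime → ringKrullDim (MvPowerSeries (Fin 3) k ⧸ P') = 1 →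
      ringKrullDim (MvPowerSeries (Fin 3) k ⧸ Q') = 1 → (X 1 : MvPowerSeries (Fin 3) k) ∉ P' → (X 1 : MvPowerSeries (Fin 3) k) ∉ Q' →
      P'.comap (substAlgHom ha : MvPowerSeries (Fin 3) k →ₐ[k] MvPowerSeries (Fin 3) k) =
        Q'.comap (substAlgHom ha : MvPowerSeries (Fin 3) k →ₐ[k] MvPowerSeries (Fin 3) k) → P' = Q' :=
  hinj_substAlgHom ha 1 (by simp) (fun i => by fin_cases i <;> simp [mul_comm])

/-- **`hB3` for the chart of the blow-up of `V(y,u₁)`** (exceptional variable `X 0`; in the curve step `e = 0`, `X (Fin.castSucc 0) = X 0`). -/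
theorem hB3_chartDivOne (ha : HasSubst (![X 0, X 1, X 0 * X 2] : Fin 3 → MvPowerSeries (Fin 3) k)) :
    ∀ (P' : Ideal (MvPowerSeries (Fin 3) k)) [P'.IsPrime], ringKrullDim (MvPowerSeries (Fin 3) k ⧸ P') = 1 →
      (X 0 : MvPowerSeries (Fin 3) k) ∉ P' →
      ringKrullDim (MvPowerSeries (Fin 3) k ⧸ P'.comap (substAlgHom ha : MvPowerSeries (Fin 3) k →ₐ[k] MvPowerSeries (Fin 3) k)) = 1 ∧
        ∀ f, branchVal (P'.comap (substAlgHom ha : MvPowerSeries (Fin 3) k →ₐ[k] MvPowerSeries (Fin 3) k)) f =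
          branchVal P' ((substAlgHom ha : MvPowerSeries (Fin 3) k →ₐ[k] MvPowerSeries (Fin 3) k) f) :=
  hB3_substAlgHom ha 0 (by simp) (fun i => by fin_cases i <;> simp)

/-- **`hinj` for the chart of the blow-up of `V(y,u₁)`.** -/
theorem hinj_chartDivOne (ha : HasSubst (![X 0, X 1, X 0 * X 2] : Fin 3 → MvPowerSeries (Fin 3) k)) :
    ∀ (P' Q' : Ideal (MvPowerSeries (Fin 3) k)), P'.IsPrime → Q'.IsPrime → ringKrullDim (MvPowerSeries (Fin 3) k ⧸ P') = 1 →
      ringKrullDim (MvPowerSeries (Fin 3) k ⧸ Q') = 1 → (X 0 : MvPowerSeries (Fin 3) k) ∉ P' → (X 0 : MvPowerSeries (Fin 3) k) ∉ Q' →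
      P'.comap (substAlgHom ha : MvPowerSeries (Fin 3) k →ₐ[k] MvPowerSeries (Fin 3) k) =
        Q'.comap (substAlgHom ha : MvPowerSeries (Fin 3) k →ₐ[k] MvPowerSeries (Fin 3) k) → P' = Q' :=
  hinj_substAlgHom ha 0 (by simp) (fun i => by fin_cases i <;> simp)

/-- **`hB3` for the chart of the blow-up of `V(y,u₂)`** (exceptional variable `X 1`; in the curve step `e = 1`). -/
theorem hB3_chartDivTwo (ha : HasSubst (![X 0, X 1, X 1 * X 2] : Fin 3 → MvPowerSeries (Fin 3) k)) :
    ∀ (P' : Ideal (MvPowerSeries (Fin 3) k)) [P'.IsPrime], ringKrullDim (MvPowerSeries (Fin 3) k ⧸ P') = 1 →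
      (X 1 : MvPowerSeries (Fin 3) k) ∉ P' →
      ringKrullDim (MvPowerSeries (Fin 3) k ⧸ P'.comap (substAlgHom ha : MvPowerSeries (Fin 3) k →ₐ[k] MvPowerSeries (Fin 3) k)) = 1 ∧
        ∀ f, branchVal (P'.comap (substAlgHom ha : MvPowerSeries (Fin 3) k →ₐ[k] MvPowerSeries (Fin 3) k)) f =
          branchVal P' ((substAlgHom ha : MvPowerSeries (Fin 3) k →ₐ[k] MvPowerSeries (Fin 3) k) f) :=
  hB3_substAlgHom ha 1 (by simp) (fun i => by fin_cases i <;> simp)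

/-- **`hinj` for the chart of the blow-up of `V(y,u₂)`.** -/
theorem hinj_chartDivTwo (ha : HasSubst (![X 0, X 1, X 1 * X 2] : Fin 3 → MvPowerSeries (Fin 3) k)) :
    ∀ (P' Q' : Ideal (MvPowerSeries (Fin 3) k)), P'.IsPrime → Q'.IsPrime → ringKrullDim (MvPowerSeries (Fin 3) k ⧸ P') = 1 →
      ringKrullDim (MvPowerSeries (Fin 3) k ⧸ Q') = 1 → (X 1 : MvPowerSeries (Fin 3) k) ∉ P' → (X 1 : MvPowerSeries (Fin 3) k) ∉ Q' →
      P'.comap (substAlgHom ha : MvPowerSeries (Fin 3) k →ₐ[k] MvPowerSeries (Fin 3) k) =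
        Q'.comap (substAlgHom ha : MvPowerSeries (Fin 3) k →ₐ[k] MvPowerSeries (Fin 3) k) → P' = Q' :=
  hinj_substAlgHom ha 1 (by simp) (fun i => by fin_cases i <;> simp)

end TOT2Branch

end Summit.ResolutionOfSingularities.ResolutionOfSingularities.Theorems

end
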